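import Mathlib
import HarnessLib
import Summits.HubbardSuperconductivity.HubbardSuperconductivity.Theorems.KLProgrammeKLRegimeSplitGenericV2
import Summits.HubbardSuperconductivity.HubbardSuperconductivity.Theorems.KLProgrammeKLRegimeTwoPointLimitShellGainProfiles

/-!
# Route `KLProgramme` — crux K3 child 3 = ENGINE, gen-3 form `KLRegimeEngineV8 := EngineP4 klPredsV8 klWindowC`: the NAMED engine
# package `EngineV8.klEngGeo`, `klEngQ P R`, `klEngC₃ P R`, `klEngU₀ P R c`, `klEngL₃`, `klEngM₃`, with its well-formedness PROVED
# (cell gate-hubbard-kl; skeleton owner hubbard-kl-k3c2-p1; package text = p1 g6's XREAD-corrected draft, HOME/p1/KLRegimeEngineV7.skeleton-p1g6.lean §1–§2)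

WHY A SECOND PACKAGE.  The gen-2 package `…Theorems.EngineV7.klEngGeo` (`KLProgrammeKLRegimeEngineV7Defs`) has gain and drive profiles
decaying like `4^{-n}` at `O(1)` transfers and amplitudes `16`/`64`.  p1 g6's XREAD (HOME/STATUS 2026-08-26T17:08:49Z), from the side that
proved Lemma E.1/E.3: at transfers on the `2k_F` CAUSTIC `2F_μ + 2πℤ²` — generic in Cooper kinematics, `k' = -k ⇒ k - k' = 2k ∈ 2F_μ` — the
two-shell pp/ph bubble at scale `n` is `≍ C√Λ_n = C√e₀·2^{-n}` (Salmhofer 1999, Lemma B.28 / (B.182)–(B.184); tree `kltb_exists_angular_bound`),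
and the certified two-shell constants on the window are `C₁ ~ 10⁶`, `C₂ ≳ 199`; so the `G`-profiles — UPPER bounds the engine must PROVE —
must carry the `C₂√e₀·2^{-n}` law and amplitudes `≥ 2^{24}`, or `stub_engine_step` is false as stated.  This package does (numbers below);
the gen-3 skeleton on the Engine-V8 item is registered AT IT.  The regime threshold `klEngC₃` is the Δ17 binder of `EngineP4`
(`∃ Q, Q.WF ∧ ∃ c₃ > 0, ∀ c ≤ c₃, …`, `…SplitGenericV4`).

THE NUMBERS (placeholders of record with head-room; a stub prover who needs larger ones re-issues the package under new names and the
skeleton is re-registered — the route item is untouched).  `klEngGeo`: block data `atop = abot = 2^{10}`, bubble-mass window `[0, 4]`,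
localisation slack `cloc = 2^{10}` at rate `θ = 1/2` (so `cloc·(Klam U)²·2^{-n}` — the caustic law's shape), drive `a χ = aplus = 2^{24}`
with profile `ζ n = 2^{-n}`, `Z = 2`; GAINS = p1b's LANDED two-shell profiles at width `w = 0` (`…TwoPointLimitShellGainProfiles`, Lemma
E.1/E.2/E.3 shapes incl. the caustic square-root term): `ppGain n ρ = ppGainOf 2^{24} 2^{24} 0 e₀ n n ρ`,
`phGain n ρ = phGainOf 2^{24} 2^{10} 2^{24} 2^{24} 0 e₀ n n (max ρ 0)`, whose freezing sums are PROVED there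
(`klgp_sum_Ioc_ppGainOf_le`, `klgp_sum_range_phGainOf_le`), `CF = 2^{40}`; `cE4 = S j = Bf = SL = 2^{10}`.  `klEngQ P R`: even powers,
`2^{20}(Klam²+1)(cr²+cz²+1)` for `CE`, `CR` (Δ15: `CR` dominates `κ·cr`; the frame's pieces sit in the propagators, so `Q` reads `R`),
`c0 = 2^{20}`, `cE4 = Bf = 2^{20}(Klam²+1)`, `S' j = 2^{20}(Klam²+1)(Gfr j²+cr²+1)`, `SL = 2^{20}(Klam²+1)(cr²+1)`,
`CL β n = 2^{20}(Klam²+1)(cr²+cz²+1)(β²+1)4ⁿ`, `L0 β = 2^{10}(⌈|β|⌉₊+1)²`, `M0 β L = 2^{10}(⌈|β|⌉₊+1)²(L+1)²`.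
`klEngC₃ P R = 2^{-40}/((Klam²+1)(cr²+cz²+1))`; `klEngU₀ P R c = 2^{-40}/((Klam²+C_W²+Cd²+1)²(cr²+cz²+1)²(c²+1))`;
`klEngL₃ β U = 2^{10}(⌈|β|⌉₊+1)²(⌈|U|⁻¹⌉₊+1)²` (`β ≤ L` — the infrared Gram constant of the scale-`0` step is β-uniform only for `L ≳ β`,
`InfraredCutoffGramConstant`; `U⁻² ≲ L`); `klEngM₃ β U L = 2^{10}(⌈|β|⌉₊+1)²(L+1)²` (`M ≥ β²`, `M ≥ L²`).
Definitions + their well-formedness (PROVED, unconditional in `P`, `R`); nothing about the model is asserted.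
-/

noncomputable section

namespace Summit.HubbardSuperconductivity.HubbardSuperconductivity.Theorems.EngineV8

set_option linter.dupNamespace false -- summit = problem name (single-conjunct summit), D-0017

open Real Finset
open Summit.HubbardSuperconductivity.HubbardSuperconductivity.Theorems.KLRegimeSplit

/-! ## §1 The named package -/

/-- **`klEngGeo` — the engine's absolute constants `G`** (chosen FIRST in `EngineP4`): block data `2^{10}`, bubble mass `≤ 4`, slack
`2^{10}·4^{-n/2}`, drive `2^{24}·2^{-n}` (mass `2`), two-shell GAIN PROFILES `ppGainOf 2^{24} 2^{24} 0 e₀ n n ρ` /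
`phGainOf 2^{24} 2^{10} 2^{24} 2^{24} 0 e₀ n n (max ρ 0)` (Lemma E.1/E.2/E.3 shapes incl. the caustic `C₂√e₀·2^{-n}`), `CF = 2^{40}`,
`cE4 = S j = Bf = SL = 2^{10}`. -/
def klEngGeo : GeoConsts where
  atop := fun _ => 2 ^ 10
  abot := fun _ => 2 ^ 10
  blo := 0
  bhi := 4
  cloc := 2 ^ 10
  θ := 1 / 2
  a := fun _ => 2 ^ 24
  ζ := fun n => ((2 : ℝ) ^ n)⁻¹
  Z := 2
  aplus := 2 ^ 24
  ppGain := fun n ρ => ppGainOf (2 ^ 24) (2 ^ 24) 0 klE0 n n ρ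
  phGain := fun n ρ => phGainOf (2 ^ 24) (2 ^ 10) (2 ^ 24) (2 ^ 24) 0 klE0 n n (max ρ 0)
  CF := 2 ^ 40
  cE4 := 2 ^ 10
  S := fun _ => 2 ^ 10
  Bf := 2 ^ 10
  SL := 2 ^ 10

/-- **`klEngQ P R` — the engine's constants `Q`** (chosen after `P` and `R`; even powers, well-formedness unconditional): `CE = CR =
2^{20}(Klam²+1)(cr²+cz²+1)`, `c0 = 2^{20}`, `cE4 = Bf = 2^{20}(Klam²+1)`, `S' j = 2^{20}(Klam²+1)(Gfr j²+cr²+1)`, `SL = 2^{20}(Klam²+1)(cr²+1)`,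
`CL β n = 2^{20}(Klam²+1)(cr²+cz²+1)(β²+1)4ⁿ`, `L0 β = 2^{10}(⌈|β|⌉₊+1)²`, `M0 β L = 2^{10}(⌈|β|⌉₊+1)²(L+1)²`. -/
def klEngQ (P : SplitConsts) (R : RenConsts) : EngConsts where
  CE := 2 ^ 20 * (P.Klam ^ 2 + 1) * (R.cr ^ 2 + R.cz ^ 2 + 1)
  CR := 2 ^ 20 * (P.Klam ^ 2 + 1) * (R.cr ^ 2 + R.cz ^ 2 + 1)
  c0 := 2 ^ 20
  cE4 := 2 ^ 20 * (P.Klam ^ 2 + 1)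
  S' := fun j => 2 ^ 20 * (P.Klam ^ 2 + 1) * (R.Gfr j ^ 2 + R.cr ^ 2 + 1)
  Bf := 2 ^ 20 * (P.Klam ^ 2 + 1)
  SL := 2 ^ 20 * (P.Klam ^ 2 + 1) * (R.cr ^ 2 + 1)
  CL := fun β n => 2 ^ 20 * (P.Klam ^ 2 + 1) * (R.cr ^ 2 + R.cz ^ 2 + 1) * (β ^ 2 + 1) * (4 : ℝ) ^ n
  L0 := fun β => 2 ^ 10 * (⌈|β|⌉₊ + 1) ^ 2
  M0 := fun β L => 2 ^ 10 * (⌈|β|⌉₊ + 1) ^ 2 * (L + 1) ^ 2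

/-- **`klEngC₃ P R` — the engine's regime-constant threshold** (Δ17, the `∃ c₃` of `EngineP4`): the scale-`n` expansion is claimed only for
`U²·n·log 4 ≤ c ≤ klEngC₃ P R`; `2^{-40}/((Klam²+1)(cr²+cz²+1))`. -/
def klEngC₃ (P : SplitConsts) (R : RenConsts) : ℝ := 1 / ((2 : ℝ) ^ 40 * (P.Klam ^ 2 + 1) * (R.cr ^ 2 + R.cz ^ 2 + 1))

/-- **`klEngU₀ P R c` — the engine's coupling threshold**: `2^{-40}/((Klam²+C_W²+Cd²+1)²(cr²+cz²+1)²(c²+1))`. -/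
def klEngU₀ (P : SplitConsts) (R : RenConsts) (c : ℝ) : ℝ :=
  1 / ((2 : ℝ) ^ 40 * (P.Klam ^ 2 + P.C_W ^ 2 + P.Cd ^ 2 + 1) ^ 2 * (R.cr ^ 2 + R.cz ^ 2 + 1) ^ 2 * (c ^ 2 + 1))

/-- **`klEngL₃ β U` — the engine's volume threshold**: `2^{10}(⌈|β|⌉₊+1)²(⌈|U|⁻¹⌉₊+1)²` (`β ≤ L`, `U⁻² ≲ L`). -/
def klEngL₃ (β U : ℝ) : ℕ := 2 ^ 10 * (⌈|β|⌉₊ + 1) ^ 2 * (⌈|U|⁻¹⌉₊ + 1) ^ 2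

/-- **`klEngM₃ β U L` — the engine's Matsubara threshold**: `2^{10}(⌈|β|⌉₊+1)²(L+1)²` (`M ≥ β²`, `M ≥ L²`). -/
def klEngM₃ (β _U : ℝ) (L : ℕ) : ℕ := 2 ^ 10 * (⌈|β|⌉₊ + 1) ^ 2 * (L + 1) ^ 2

/-! ## §2 Well-formedness of the package (PROVED) -/

/-- `√e₀ ≤ 1`. -/
theorem sqrt_klE0_le_one : Real.sqrt klE0 ≤ 1 := by
  rw [Real.sqrt_le_one]; norm_num [klE0]

/-- At width `w = 0` the pp profile does not read the resolution index. -/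
theorem ppGainOf_w0_indep (C₁ C₂ e₀ : ℝ) (n m m' : ℕ) (ρ : ℝ) :
    ppGainOf C₁ C₂ 0 e₀ n m ρ = ppGainOf C₁ C₂ 0 e₀ n m' ρ := by
  simp [ppGainOf]

/-- At width `w = 0` the ph profile does not read the resolution index. -/
theorem phGainOf_w0_indep (C₀ K C₁ C₂ e₀ : ℝ) (n m m' : ℕ) (ρ : ℝ) :
    phGainOf C₀ K C₁ C₂ 0 e₀ n m ρ = phGainOf C₀ K C₁ C₂ 0 e₀ n m' ρ := by
  simp [phGainOf]

/-- **`klEngGeo` is well formed** (signs, `θ = 1/2`, drive mass `Σ 2^{-n} ≤ 2`, and the two FREEZING sums of the gain profiles —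
`klgp_sum_range_phGainOf_le` / `klgp_sum_Ioc_ppGainOf_le` at `w = 0`, dominated by `CF = 2^{40}`). -/
theorem klEngGeo_wf : klEngGeo.WF := by
  refine ⟨fun _ => by norm_num [klEngGeo], fun _ => by norm_num [klEngGeo], by norm_num [klEngGeo], by norm_num [klEngGeo],
    by norm_num [klEngGeo], by norm_num [klEngGeo], by norm_num [klEngGeo], fun _ => by norm_num [klEngGeo],
    fun n => by simp [klEngGeo], fun N => ?_, by norm_num [klEngGeo], fun n ρ => ?_, fun n ρ => ?_, by norm_num [klEngGeo],
    fun ρ N hρ => ?_, fun ρ t N hρ => ?_, by norm_num [klEngGeo], fun _ => by norm_num [klEngGeo], by norm_num [klEngGeo],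
    by norm_num [klEngGeo]⟩
  · -- drive mass
    show ∑ n ∈ range N, ((2 : ℝ) ^ n)⁻¹ ≤ 2
    exact klgp_sum_range_inv_two_pow_le N
  · -- pp gain ≥ 0
    show 0 ≤ ppGainOf (2 ^ 24) (2 ^ 24) 0 klE0 n n ρ
    exact klgp_ppGainOf_nonneg (by norm_num) (by norm_num) (le_of_lt (by norm_num [klE0] : (0 : ℝ) < klE0)) 0 n n ρ
  · -- ph gain ≥ 0
    show 0 ≤ phGainOf (2 ^ 24) (2 ^ 10) (2 ^ 24) (2 ^ 24) 0 klE0 n n (max ρ 0)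
    exact klgp_phGainOf_nonneg (by norm_num) (by norm_num) (by norm_num) (by norm_num) le_rfl (le_of_lt (by norm_num [klE0] : (0 : ℝ) < klE0)) n n
      (le_max_right _ _)
  · -- ph freezing sum, uniform in the transfer
    show ∑ n ∈ range N, phGainOf (2 ^ 24) (2 ^ 10) (2 ^ 24) (2 ^ 24) 0 klE0 n n (max ρ 0) ≤ 2 ^ 40
    rw [max_eq_left hρ]
    cases N with
    | zero => simp
    | succ m =>
      rw [sum_congr rfl fun n _ => phGainOf_w0_indep (2 ^ 24) (2 ^ 10) (2 ^ 24) (2 ^ 24) klE0 n n m ρ]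
      have h := klgp_sum_range_phGainOf_le (C₀ := 2 ^ 24) (K := 2 ^ 10) (C₁ := 2 ^ 24) (C₂ := 2 ^ 24) (w := 0) (e₀ := klE0)
        (by norm_num) (by norm_num) (by norm_num) (by norm_num) le_rfl (by norm_num [klE0] : (0 : ℝ) < klE0) m hρ
      have hs := sqrt_klE0_le_one
      have h0 : (3 : ℝ) * 2 ^ 10 * 0 / klE0 = 0 := by simp
      rw [h0] at h
      have : (4 : ℝ) / 3 * 2 ^ 24 + 4 / 3 + 4 * 2 ^ 24 * 2 ^ 10 + 2 * 2 ^ 24 * Real.sqrt klE0 + (0 + 1) ≤ 2 ^ 40 := by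
        nlinarith [Real.sqrt_nonneg klE0]
      exact h.trans this
  · -- pp freezing sum below the transfer's own scale
    show ∑ n ∈ Ioc t N, ppGainOf (2 ^ 24) (2 ^ 24) 0 klE0 n n ρ ≤ 2 ^ 40
    rw [sum_congr rfl fun n _ => ppGainOf_w0_indep (2 ^ 24) (2 ^ 24) klE0 n n N ρ]
    have h := klgp_sum_Ioc_ppGainOf_le (C₁ := 2 ^ 24) (C₂ := 2 ^ 24) (w := 0) (e₀ := klE0)
      (by norm_num) (by norm_num) le_rfl (le_of_lt (by norm_num [klE0] : (0 : ℝ) < klE0)) N t hρ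
    have hs := sqrt_klE0_le_one
    have : (2 : ℝ) * 0 + 1 + 8 / 3 * 2 ^ 24 * klE0 + 2 ^ 24 * Real.sqrt klE0 ≤ 2 ^ 40 := by
      have : klE0 = 1 / 32 := by norm_num [klE0]
      nlinarith [Real.sqrt_nonneg klE0]
    exact h.trans this

/-- **`klEngQ P R` is well formed** (all entries manifestly nonnegative). -/
theorem klEngQ_wf (P : SplitConsts) (R : RenConsts) : (klEngQ P R).WF := by
  refine ⟨?_, ?_, by norm_num [klEngQ], ?_, fun j => ?_, ?_, ?_, fun β n => ?_⟩
  · show (0 : ℝ) ≤ 2 ^ 20 * (P.Klam ^ 2 + 1) * (R.cr ^ 2 + R.cz ^ 2 + 1); positivity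
  · show (0 : ℝ) ≤ 2 ^ 20 * (P.Klam ^ 2 + 1) * (R.cr ^ 2 + R.cz ^ 2 + 1); positivity
  · show (0 : ℝ) ≤ 2 ^ 20 * (P.Klam ^ 2 + 1); positivity
  · show (0 : ℝ) ≤ 2 ^ 20 * (P.Klam ^ 2 + 1) * (R.Gfr j ^ 2 + R.cr ^ 2 + 1); positivity
  · show (0 : ℝ) ≤ 2 ^ 20 * (P.Klam ^ 2 + 1); positivity
  · show (0 : ℝ) ≤ 2 ^ 20 * (P.Klam ^ 2 + 1) * (R.cr ^ 2 + 1); positivity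
  · show (0 : ℝ) ≤ 2 ^ 20 * (P.Klam ^ 2 + 1) * (R.cr ^ 2 + R.cz ^ 2 + 1) * (β ^ 2 + 1) * (4 : ℝ) ^ n; positivity

/-- `0 < klEngC₃ P R`. -/
theorem klEngC₃_pos (P : SplitConsts) (R : RenConsts) : 0 < klEngC₃ P R := by
  unfold klEngC₃; positivity

/-- `0 < klEngU₀ P R c`. -/
theorem klEngU₀_pos (P : SplitConsts) (R : RenConsts) (c : ℝ) : 0 < klEngU₀ P R c := by
  unfold klEngU₀; positivity

/-- **The package is well formed, bundled as the `EngineP4` composition consumes it**: `klEngGeo.WF`, and for all `P`, `R`: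
`(klEngQ P R).WF`, `0 < klEngC₃ P R`, `0 < klEngU₀ P R c`. -/
theorem klEng_package_wf :
    klEngGeo.WF ∧ ∀ (P : SplitConsts) (R : RenConsts), (klEngQ P R).WF ∧ 0 < klEngC₃ P R ∧ ∀ c : ℝ, 0 < klEngU₀ P R c :=
  ⟨klEngGeo_wf, fun P R => ⟨klEngQ_wf P R, klEngC₃_pos P R, fun c => klEngU₀_pos P R c⟩⟩

/-! ## §3 What the thresholds buy (for the scale-`0` stub provers) -/

/-- `β ≤ L` beyond the engine's volume threshold. -/
theorem le_of_klEngL₃_le {β U : ℝ} {L : ℕ} (h : klEngL₃ β U ≤ L) : β ≤ L := by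
  unfold klEngL₃ at h
  have h1 : β ≤ |β| := le_abs_self β
  have h2 : |β| ≤ (⌈|β|⌉₊ : ℝ) := Nat.le_ceil _
  have h3 : ((2 ^ 10 * (⌈|β|⌉₊ + 1) ^ 2 * (⌈|U|⁻¹⌉₊ + 1) ^ 2 : ℕ) : ℝ) ≤ (L : ℝ) := by exact_mod_cast h
  push_cast at h3
  have h4 : (1 : ℝ) ≤ ((⌈|U|⁻¹⌉₊ : ℝ) + 1) ^ 2 := by
    have : (0 : ℝ) ≤ ⌈|U|⁻¹⌉₊ := Nat.cast_nonneg _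
    nlinarith
  have h5 : ((⌈|β|⌉₊ : ℝ)) ≤ ((⌈|β|⌉₊ : ℝ) + 1) ^ 2 := by
    have : (0 : ℝ) ≤ ⌈|β|⌉₊ := Nat.cast_nonneg _
    nlinarith
  have h6 : ((⌈|β|⌉₊ : ℝ) + 1) ^ 2 ≤ 2 ^ 10 * ((⌈|β|⌉₊ : ℝ) + 1) ^ 2 * ((⌈|U|⁻¹⌉₊ : ℝ) + 1) ^ 2 := by
    have hsq : (0 : ℝ) ≤ ((⌈|β|⌉₊ : ℝ) + 1) ^ 2 := sq_nonneg _
    nlinarith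
  linarith

/-- `β² ≤ M` and `L² ≤ M` beyond the engine's Matsubara threshold. -/
theorem sq_le_of_klEngM₃_le {β U : ℝ} {L M : ℕ} (h : klEngM₃ β U L ≤ M) : β ^ 2 ≤ M ∧ (L : ℝ) ^ 2 ≤ M := by
  unfold klEngM₃ at h
  have h3 : ((2 ^ 10 * (⌈|β|⌉₊ + 1) ^ 2 * (L + 1) ^ 2 : ℕ) : ℝ) ≤ (M : ℝ) := by exact_mod_cast h
  push_cast at h3
  have hb : β ^ 2 ≤ ((⌈|β|⌉₊ : ℝ) + 1) ^ 2 := by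
    have h1 : |β| ≤ (⌈|β|⌉₊ : ℝ) := Nat.le_ceil _
    have h2 : |β| ≤ (⌈|β|⌉₊ : ℝ) + 1 := by linarith
    calc β ^ 2 = |β| ^ 2 := (sq_abs β).symm
      _ ≤ ((⌈|β|⌉₊ : ℝ) + 1) ^ 2 := pow_le_pow_left₀ (abs_nonneg β) h2 2
  have hL1 : (1 : ℝ) ≤ ((L : ℝ) + 1) ^ 2 := by
    have : (0 : ℝ) ≤ L := Nat.cast_nonneg _
    nlinarith
  have hB1 : (1 : ℝ) ≤ ((⌈|β|⌉₊ : ℝ) + 1) ^ 2 := by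
    have : (0 : ℝ) ≤ ⌈|β|⌉₊ := Nat.cast_nonneg _
    nlinarith
  have hLsq : (L : ℝ) ^ 2 ≤ ((L : ℝ) + 1) ^ 2 := by
    have : (0 : ℝ) ≤ L := Nat.cast_nonneg _
    nlinarith
  constructor
  · have : ((⌈|β|⌉₊ : ℝ) + 1) ^ 2 ≤ 2 ^ 10 * ((⌈|β|⌉₊ : ℝ) + 1) ^ 2 * ((L : ℝ) + 1) ^ 2 := by
      have hsq : (0 : ℝ) ≤ ((⌈|β|⌉₊ : ℝ) + 1) ^ 2 := sq_nonneg _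
      nlinarith
    linarith
  · have : ((L : ℝ) + 1) ^ 2 ≤ 2 ^ 10 * ((⌈|β|⌉₊ : ℝ) + 1) ^ 2 * ((L : ℝ) + 1) ^ 2 := by
      have hsq : (0 : ℝ) ≤ ((L : ℝ) + 1) ^ 2 := sq_nonneg _
      nlinarith
    linarith

end Summit.HubbardSuperconductivity.HubbardSuperconductivity.Theorems.EngineV8

end
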